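import Summits.QuantumFields.YangMills.Theorems.ColdStartUniversalityLatticeLangevinRegularFlow
import Summits.QuantumFields.YangMills.Theorems.ColdStartUniversalityLatticeLangevinShift
import HarnessLib

/-!
# Route `ColdStartUniversality` (rung input (M), crux K_A1 stmt-QuantumFields-24809): SPLICING a regular flow at time
# `s` — adaptedness, progressive measurability and a.s. path continuity of the restarted process

Helper file (seat `ym-line-csu-p1`, g4); measurability half of the splicing proof of the flow (cocycle) property
(hypothesis of `chapmanKolmogorov_of_cocycle`).  On the canonical continuous-path space with the law of a flat Brownian
motion, a regular flow `U` (`exists_regularFlow`: progressively measurable jointly in the start, continuity certificate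
`G`) and the shift `θ_s p = p(s+·) − p(s)`, the SPLICED process

  `X u p = U x u p` (`u ≤ s`),   `X u p = U (U x s p) (u − s) (θ_s p)` (`u > s`)

(run the flow from `x` up to time `s`, then restart it from the point reached with the shifted noise) is adapted to the
raw natural filtration (`measurable_splice`), progressively measurable (`measurable_splice_prog`), jointly measurable in
(time, path) (`measurable_uncurry_of_prog`), and has a.s. continuous paths (`ae_continuous_splice`) — by the filtration
measurability of the shift (`measurable_shift_natFiltration`) and freezing of the `𝓕_s`-measurable restart point against
the independent shifted path (`ae_mem_of_forall_prob_eq_one`).  The Itô part (the spliced process solves the SZZ system,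
hence equals `U x` by pathwise uniqueness) is the next file.  No definition, no sorry.  RECORD-rung R3 plumbing; nothing
here bears on the mass gap.
-/

set_option autoImplicit false

noncomputable section

namespace Summit.QuantumFields.YangMills.Theorems.ColdStartUniversality

open MeasureTheory ProbabilityTheory Filter Topology
open scoped NNReal ENNReal BigOperators
open Literature Literature.Probability.Process Literature.MathematicalPhysics.QuantumFieldTheory

/-! ## Generic measurability wrappers (σ-algebras by unification, not instance search) -/

section Wrappers

/-- `ite` of measurable maps along a measurable condition (all σ-algebras implicit). [folklore] -/
theorem measurable_ite' {α β : Type*} {mα : MeasurableSpace α} {mβ : MeasurableSpace β} {c : α → Prop}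
    [DecidablePred c] {f g : α → β} (hc : MeasurableSet {a | c a}) (hf : Measurable f) (hg : Measurable g) :
    Measurable fun a => if c a then f a else g a :=
  Measurable.ite hc hf hg

/-- Measurable into a subtype (all σ-algebras implicit). [folklore] -/
theorem measurable_subtype_mk' {α β : Type*} {mα : MeasurableSpace α} {mβ : MeasurableSpace β} {p : β → Prop}
    {f : α → β} (hf : Measurable f) (h : ∀ a, p (f a)) : Measurable fun a => (⟨f a, h a⟩ : Subtype p) :=
  hf.subtype_mk

/-- Measurable ⇒ strongly measurable into `ℝ` (all σ-algebras implicit). [folklore] -/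
theorem stronglyMeasurable_real_of_measurable {α : Type*} {mα : MeasurableSpace α} {f : α → ℝ}
    (hf : Measurable f) : StronglyMeasurable f :=
  hf.stronglyMeasurable

/-- **Gluing progressive measurability into joint measurability in (time, ω)**: if for every `n : ℕ` the restriction of
`Z` to `[0, n] × Ω` is measurable for `𝓑 ⊗ m_n` with `m_n ≤ m`, then `(ω, t) ↦ Z t⁺ ω` is measurable for `m ⊗ 𝓑(ℝ)`
(the form the tree's `IsApproxSeq`/sampling lemmas consume). [folklore] -/
theorem measurable_uncurry_of_prog {Ω β : Type*} {mΩ : MeasurableSpace Ω} [TopologicalSpace β]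
    [TopologicalSpace.PseudoMetrizableSpace β] [MeasurableSpace β] [BorelSpace β]
    {Z : ℝ≥0 → Ω → β} (m : ℕ → MeasurableSpace Ω) (hm : ∀ n, m n ≤ mΩ)
    (hZ : ∀ n : ℕ, Measurable[@Prod.instMeasurableSpace (Set.Iic (n : ℝ≥0)) Ω inferInstance (m n)]
      (fun q : Set.Iic (n : ℝ≥0) × Ω => Z q.1 q.2)) :
    Measurable fun q : Ω × ℝ => Z q.2.toNNReal q.1 := by
  -- `Z t ω = lim_n Z (t ∧ n) ω`, eventually constant
  have hg : ∀ n : ℕ, Measurable fun q : Ω × ℝ => Z (min q.2.toNNReal n) q.1 := by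
    intro n
    have h1 : Measurable[@Prod.instMeasurableSpace (Set.Iic (n : ℝ≥0)) Ω inferInstance mΩ]
        (fun q : Set.Iic (n : ℝ≥0) × Ω => Z q.1 q.2) :=
      (hZ n).mono (by exact sup_le_sup le_rfl (MeasurableSpace.comap_mono (hm n))) le_rfl
    have h2 : Measurable fun q : Ω × ℝ => ((⟨min q.2.toNNReal n, Set.mem_Iic.2 (min_le_right _ _)⟩ :
        Set.Iic (n : ℝ≥0)), q.1) :=
      (measurable_subtype_mk' ((measurable_real_toNNReal.comp measurable_snd).min measurable_const) _).prodMk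
        measurable_fst
    have h3 := h1.comp h2
    exact h3
  refine measurable_of_tendsto_metrizable hg ?_
  rw [tendsto_pi_nhds]
  intro q
  refine tendsto_const_nhds.congr' ?_
  obtain ⟨n₀, hn₀⟩ := exists_nat_ge q.2.toNNReal
  filter_upwards [eventually_ge_atTop n₀] with n hn
  rw [min_eq_left (hn₀.trans (by exact_mod_cast hn))]

end Wrappers

/-! ## The spliced process on the canonical space -/

section Splice

variable {Ω : Type} [MeasurableSpace Ω] {P : Measure Ω} [IsProbabilityMeasure P] {L : ℕ} [NeZero L]
  {W : ℝ≥0 → Ω → (Edge 3 L × NoiseIdx 2 → ℝ)}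

/-- **The restarted leg is adapted**: with `U` progressively measurable jointly in the start (for `𝓑 ⊗ 𝓑 ⊗ 𝓕_r`) and an
`𝓕_s`-measurable restart point `Y`, `p ↦ U (Y p) r (θ_s p)` is `𝓕_{s+r}`-measurable. [folklore] -/
theorem measurable_restart (hW : IsFlatBrownian W P)
    (U : GaugeConfig 3 L (Matrix.specialUnitaryGroup (Fin 2) ℂ) → ℝ≥0 →
      {p : ℝ≥0 → (Edge 3 L × NoiseIdx 2 → ℝ) // Continuous p ∧ p 0 = 0} →
      GaugeConfig 3 L (Matrix.specialUnitaryGroup (Fin 2) ℂ))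
    (hprog : ∀ i : ℝ≥0, Measurable[@Prod.instMeasurableSpace (Set.Iic i)
        (GaugeConfig 3 L (Matrix.specialUnitaryGroup (Fin 2) ℂ) ×
          {p : ℝ≥0 → (Edge 3 L × NoiseIdx 2 → ℝ) // Continuous p ∧ p 0 = 0}) inferInstance
        (@Prod.instMeasurableSpace (GaugeConfig 3 L (Matrix.specialUnitaryGroup (Fin 2) ℂ))
          {p : ℝ≥0 → (Edge 3 L × NoiseIdx 2 → ℝ) // Continuous p ∧ p 0 = 0} inferInstance
          ((isFlatBrownian_canonical hW).natFiltration i))]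
      (fun q : Set.Iic i × (GaugeConfig 3 L (Matrix.specialUnitaryGroup (Fin 2) ℂ) ×
        {p : ℝ≥0 → (Edge 3 L × NoiseIdx 2 → ℝ) // Continuous p ∧ p 0 = 0}) => U q.2.1 q.1 q.2.2))
    (s : ℝ≥0) {Y : {p : ℝ≥0 → (Edge 3 L × NoiseIdx 2 → ℝ) // Continuous p ∧ p 0 = 0} →
      GaugeConfig 3 L (Matrix.specialUnitaryGroup (Fin 2) ℂ)}
    (hY : Measurable[(isFlatBrownian_canonical hW).natFiltration s] Y) (i : ℝ≥0) :
    Measurable[@Prod.instMeasurableSpace (Set.Iic i) {p : ℝ≥0 → (Edge 3 L × NoiseIdx 2 → ℝ) // Continuous p ∧ p 0 = 0}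
        inferInstance ((isFlatBrownian_canonical hW).natFiltration (s + i))]
      (fun q : Set.Iic i × {p : ℝ≥0 → (Edge 3 L × NoiseIdx 2 → ℝ) // Continuous p ∧ p 0 = 0} =>
        U (Y q.2) q.1 ⟨fun u => q.2.1 (s + u) - q.2.1 s,
          continuous_shiftPath_and_zero (isFlatBrownian_canonical hW) s q.2⟩) := by
  have hθ := measurable_shift_natFiltration hW s i
  have hY' : Measurable[(isFlatBrownian_canonical hW).natFiltration (s + i)] Y :=
    hY.mono ((isFlatBrownian_canonical hW).natFiltration.mono le_self_add) le_rfl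
  -- the map `q ↦ (q.1, (Y q.2, θ q.2))`
  have hmap : @Measurable (Set.Iic i × {p : ℝ≥0 → (Edge 3 L × NoiseIdx 2 → ℝ) // Continuous p ∧ p 0 = 0})
      (Set.Iic i × (GaugeConfig 3 L (Matrix.specialUnitaryGroup (Fin 2) ℂ) ×
        {p : ℝ≥0 → (Edge 3 L × NoiseIdx 2 → ℝ) // Continuous p ∧ p 0 = 0}))
      (@Prod.instMeasurableSpace _ _ inferInstance ((isFlatBrownian_canonical hW).natFiltration (s + i)))
      (@Prod.instMeasurableSpace _ _ inferInstance (@Prod.instMeasurableSpace _ _ inferInstance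
        ((isFlatBrownian_canonical hW).natFiltration i)))
      (fun q => (q.1, (Y q.2, (⟨fun u => q.2.1 (s + u) - q.2.1 s,
        continuous_shiftPath_and_zero (isFlatBrownian_canonical hW) s q.2⟩ :
          {p : ℝ≥0 → (Edge 3 L × NoiseIdx 2 → ℝ) // Continuous p ∧ p 0 = 0})))) :=
    measurable_fst.prodMk ((hY'.comp measurable_snd).prodMk (hθ.comp measurable_snd))
  have h := (hprog i).comp hmap
  exact h

/-- **The spliced process is adapted** to the raw natural filtration of the coordinate process. [folklore] -/
theorem measurable_splice (hW : IsFlatBrownian W P)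
    (U : GaugeConfig 3 L (Matrix.specialUnitaryGroup (Fin 2) ℂ) → ℝ≥0 →
      {p : ℝ≥0 → (Edge 3 L × NoiseIdx 2 → ℝ) // Continuous p ∧ p 0 = 0} →
      GaugeConfig 3 L (Matrix.specialUnitaryGroup (Fin 2) ℂ))
    (hprog : ∀ i : ℝ≥0, Measurable[@Prod.instMeasurableSpace (Set.Iic i)
        (GaugeConfig 3 L (Matrix.specialUnitaryGroup (Fin 2) ℂ) ×
          {p : ℝ≥0 → (Edge 3 L × NoiseIdx 2 → ℝ) // Continuous p ∧ p 0 = 0}) inferInstance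
        (@Prod.instMeasurableSpace (GaugeConfig 3 L (Matrix.specialUnitaryGroup (Fin 2) ℂ))
          {p : ℝ≥0 → (Edge 3 L × NoiseIdx 2 → ℝ) // Continuous p ∧ p 0 = 0} inferInstance
          ((isFlatBrownian_canonical hW).natFiltration i))]
      (fun q : Set.Iic i × (GaugeConfig 3 L (Matrix.specialUnitaryGroup (Fin 2) ℂ) ×
        {p : ℝ≥0 → (Edge 3 L × NoiseIdx 2 → ℝ) // Continuous p ∧ p 0 = 0}) => U q.2.1 q.1 q.2.2))
    (x : GaugeConfig 3 L (Matrix.specialUnitaryGroup (Fin 2) ℂ)) (s u : ℝ≥0) :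
    Measurable[(isFlatBrownian_canonical hW).natFiltration u]
      (fun p : {p : ℝ≥0 → (Edge 3 L × NoiseIdx 2 → ℝ) // Continuous p ∧ p 0 = 0} =>
        if u ≤ s then U x u p else U (U x s p) (u - s) ⟨fun v => p.1 (s + v) - p.1 s,
          continuous_shiftPath_and_zero (isFlatBrownian_canonical hW) s p⟩) := by
  -- adaptedness of the flow at a fixed start from progressivity
  have hadapt : ∀ (y : GaugeConfig 3 L (Matrix.specialUnitaryGroup (Fin 2) ℂ)) (r : ℝ≥0),
      Measurable[(isFlatBrownian_canonical hW).natFiltration r] (U y r) := by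
    intro y r
    have hmap : @Measurable {p : ℝ≥0 → (Edge 3 L × NoiseIdx 2 → ℝ) // Continuous p ∧ p 0 = 0}
        (Set.Iic r × (GaugeConfig 3 L (Matrix.specialUnitaryGroup (Fin 2) ℂ) ×
          {p : ℝ≥0 → (Edge 3 L × NoiseIdx 2 → ℝ) // Continuous p ∧ p 0 = 0}))
        ((isFlatBrownian_canonical hW).natFiltration r)
        (@Prod.instMeasurableSpace _ _ inferInstance (@Prod.instMeasurableSpace _ _ inferInstance
          ((isFlatBrownian_canonical hW).natFiltration r)))
        (fun p => ((⟨r, Set.mem_Iic.2 le_rfl⟩ : Set.Iic r), (y, p))) :=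
      measurable_const.prodMk (measurable_const.prodMk measurable_id)
    have h := (hprog r).comp hmap
    exact h
  by_cases hu : u ≤ s
  · simp only [if_pos hu]
    exact hadapt x u
  · simp only [if_neg hu]
    have hsu : s + (u - s) = u := add_tsub_cancel_of_le (le_of_not_ge hu)
    have h := measurable_restart hW U hprog s (hadapt x s) (u - s)
    have hmap : @Measurable {p : ℝ≥0 → (Edge 3 L × NoiseIdx 2 → ℝ) // Continuous p ∧ p 0 = 0}
        (Set.Iic (u - s) × {p : ℝ≥0 → (Edge 3 L × NoiseIdx 2 → ℝ) // Continuous p ∧ p 0 = 0})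
        ((isFlatBrownian_canonical hW).natFiltration (s + (u - s)))
        (@Prod.instMeasurableSpace _ _ inferInstance ((isFlatBrownian_canonical hW).natFiltration (s + (u - s))))
        (fun p => ((⟨u - s, Set.mem_Iic.2 le_rfl⟩ : Set.Iic (u - s)), p)) :=
      measurable_const.prodMk measurable_id
    have h2 := h.comp hmap
    rw [hsu] at h2
    exact h2

/-- **The spliced process is progressively measurable** (for `𝓑([0,i₀]) ⊗ 𝓕_{i₀}` on `[0, i₀] × Ωc`). [folklore] -/
theorem measurable_splice_prog (hW : IsFlatBrownian W P)
    (U : GaugeConfig 3 L (Matrix.specialUnitaryGroup (Fin 2) ℂ) → ℝ≥0 →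
      {p : ℝ≥0 → (Edge 3 L × NoiseIdx 2 → ℝ) // Continuous p ∧ p 0 = 0} →
      GaugeConfig 3 L (Matrix.specialUnitaryGroup (Fin 2) ℂ))
    (hprog : ∀ i : ℝ≥0, Measurable[@Prod.instMeasurableSpace (Set.Iic i)
        (GaugeConfig 3 L (Matrix.specialUnitaryGroup (Fin 2) ℂ) ×
          {p : ℝ≥0 → (Edge 3 L × NoiseIdx 2 → ℝ) // Continuous p ∧ p 0 = 0}) inferInstance
        (@Prod.instMeasurableSpace (GaugeConfig 3 L (Matrix.specialUnitaryGroup (Fin 2) ℂ))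
          {p : ℝ≥0 → (Edge 3 L × NoiseIdx 2 → ℝ) // Continuous p ∧ p 0 = 0} inferInstance
          ((isFlatBrownian_canonical hW).natFiltration i))]
      (fun q : Set.Iic i × (GaugeConfig 3 L (Matrix.specialUnitaryGroup (Fin 2) ℂ) ×
        {p : ℝ≥0 → (Edge 3 L × NoiseIdx 2 → ℝ) // Continuous p ∧ p 0 = 0}) => U q.2.1 q.1 q.2.2))
    (x : GaugeConfig 3 L (Matrix.specialUnitaryGroup (Fin 2) ℂ)) (s i₀ : ℝ≥0) :
    Measurable[@Prod.instMeasurableSpace (Set.Iic i₀) {p : ℝ≥0 → (Edge 3 L × NoiseIdx 2 → ℝ) // Continuous p ∧ p 0 = 0}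
        inferInstance ((isFlatBrownian_canonical hW).natFiltration i₀)]
      (fun q : Set.Iic i₀ × {p : ℝ≥0 → (Edge 3 L × NoiseIdx 2 → ℝ) // Continuous p ∧ p 0 = 0} =>
        if (q.1 : ℝ≥0) ≤ s then U x q.1 q.2 else U (U x s q.2) (q.1 - s) ⟨fun v => q.2.1 (s + v) - q.2.1 s,
          continuous_shiftPath_and_zero (isFlatBrownian_canonical hW) s q.2⟩) := by
  -- first leg, progressive
  have hfirst : Measurable[@Prod.instMeasurableSpace (Set.Iic i₀) {p : ℝ≥0 → (Edge 3 L × NoiseIdx 2 → ℝ) //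
      Continuous p ∧ p 0 = 0} inferInstance ((isFlatBrownian_canonical hW).natFiltration i₀)]
      (fun q : Set.Iic i₀ × {p : ℝ≥0 → (Edge 3 L × NoiseIdx 2 → ℝ) // Continuous p ∧ p 0 = 0} => U x q.1 q.2) := by
    have hmap : @Measurable (Set.Iic i₀ × {p : ℝ≥0 → (Edge 3 L × NoiseIdx 2 → ℝ) // Continuous p ∧ p 0 = 0})
        (Set.Iic i₀ × (GaugeConfig 3 L (Matrix.specialUnitaryGroup (Fin 2) ℂ) ×
          {p : ℝ≥0 → (Edge 3 L × NoiseIdx 2 → ℝ) // Continuous p ∧ p 0 = 0}))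
        (@Prod.instMeasurableSpace _ _ inferInstance ((isFlatBrownian_canonical hW).natFiltration i₀))
        (@Prod.instMeasurableSpace _ _ inferInstance (@Prod.instMeasurableSpace _ _ inferInstance
          ((isFlatBrownian_canonical hW).natFiltration i₀)))
        (fun q => (q.1, (x, q.2))) :=
      measurable_fst.prodMk (measurable_const.prodMk measurable_snd)
    have h := (hprog i₀).comp hmap
    exact h
  by_cases hs : s ≤ i₀
  · -- both legs are measurable for `𝓕_{i₀}`
    have hYs : Measurable[(isFlatBrownian_canonical hW).natFiltration s] (U x s) := by
      have hmap : @Measurable {p : ℝ≥0 → (Edge 3 L × NoiseIdx 2 → ℝ) // Continuous p ∧ p 0 = 0}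
          (Set.Iic s × (GaugeConfig 3 L (Matrix.specialUnitaryGroup (Fin 2) ℂ) ×
            {p : ℝ≥0 → (Edge 3 L × NoiseIdx 2 → ℝ) // Continuous p ∧ p 0 = 0}))
          ((isFlatBrownian_canonical hW).natFiltration s)
          (@Prod.instMeasurableSpace _ _ inferInstance (@Prod.instMeasurableSpace _ _ inferInstance
            ((isFlatBrownian_canonical hW).natFiltration s)))
          (fun p => ((⟨s, Set.mem_Iic.2 le_rfl⟩ : Set.Iic s), (x, p))) :=
        measurable_const.prodMk (measurable_const.prodMk measurable_id)
      have h := (hprog s).comp hmap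
      exact h
    have hsecond := measurable_restart hW U hprog s hYs (i₀ - s)
    have hsi : s + (i₀ - s) = i₀ := add_tsub_cancel_of_le hs
    -- reparametrise the time `q.1 ↦ q.1 - s ∈ [0, i₀ - s]`
    have hmap : @Measurable (Set.Iic i₀ × {p : ℝ≥0 → (Edge 3 L × NoiseIdx 2 → ℝ) // Continuous p ∧ p 0 = 0})
        (Set.Iic (i₀ - s) × {p : ℝ≥0 → (Edge 3 L × NoiseIdx 2 → ℝ) // Continuous p ∧ p 0 = 0})
        (@Prod.instMeasurableSpace _ _ inferInstance ((isFlatBrownian_canonical hW).natFiltration i₀))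
        (@Prod.instMeasurableSpace _ _ inferInstance ((isFlatBrownian_canonical hW).natFiltration (s + (i₀ - s))))
        (fun q => ((⟨(q.1 : ℝ≥0) - s, Set.mem_Iic.2 (tsub_le_tsub_right (Set.mem_Iic.1 q.1.2) s)⟩ :
          Set.Iic (i₀ - s)), q.2)) := by
      rw [hsi]
      exact (measurable_subtype_mk' ((measurable_subtype_coe.comp measurable_fst).sub measurable_const) _).prodMk
        measurable_snd
    have h2 := hsecond.comp hmap
    refine measurable_ite' ?_ hfirst h2
    exact measurableSet_le (measurable_subtype_coe.comp measurable_fst) measurable_const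
  · -- `i₀ < s`: the spliced process is the first leg on `[0, i₀]`
    have heq : (fun q : Set.Iic i₀ × {p : ℝ≥0 → (Edge 3 L × NoiseIdx 2 → ℝ) // Continuous p ∧ p 0 = 0} =>
        if (q.1 : ℝ≥0) ≤ s then U x q.1 q.2 else U (U x s q.2) (q.1 - s) ⟨fun v => q.2.1 (s + v) - q.2.1 s,
          continuous_shiftPath_and_zero (isFlatBrownian_canonical hW) s q.2⟩) =
        fun q => U x q.1 q.2 := by
      funext q
      rw [if_pos ((Set.mem_Iic.1 q.1.2).trans (le_of_not_ge hs))]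
    rw [heq]
    exact hfirst

/-- **Path continuity of a splice**: legs continuous and matching at the junction. [folklore] -/
theorem continuous_splice_path {β : Type*} [TopologicalSpace β] {f g : ℝ≥0 → β} (s : ℝ≥0)
    (hf : Continuous f) (hg : Continuous g) (h : f s = g 0) :
    Continuous fun u => if u ≤ s then f u else g (u - s) := by
  refine Continuous.if_le hf (hg.comp (continuous_id.sub continuous_const)) continuous_id continuous_const ?_
  intro u hu
  simp only [hu, tsub_self, h]

/-- **The spliced process has a.s. continuous paths**, given the continuity certificate of the regular flow (the
restart point is frozen against the independent shifted path). [folklore] -/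
theorem ae_continuous_splice (hW : IsFlatBrownian W P)
    (U : GaugeConfig 3 L (Matrix.specialUnitaryGroup (Fin 2) ℂ) → ℝ≥0 →
      {p : ℝ≥0 → (Edge 3 L × NoiseIdx 2 → ℝ) // Continuous p ∧ p 0 = 0} →
      GaugeConfig 3 L (Matrix.specialUnitaryGroup (Fin 2) ℂ))
    (hU0 : ∀ y p, U y 0 p = y)
    (hprog : ∀ i : ℝ≥0, Measurable[@Prod.instMeasurableSpace (Set.Iic i)
        (GaugeConfig 3 L (Matrix.specialUnitaryGroup (Fin 2) ℂ) ×
          {p : ℝ≥0 → (Edge 3 L × NoiseIdx 2 → ℝ) // Continuous p ∧ p 0 = 0}) inferInstance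
        (@Prod.instMeasurableSpace (GaugeConfig 3 L (Matrix.specialUnitaryGroup (Fin 2) ℂ))
          {p : ℝ≥0 → (Edge 3 L × NoiseIdx 2 → ℝ) // Continuous p ∧ p 0 = 0} inferInstance
          ((isFlatBrownian_canonical hW).natFiltration i))]
      (fun q : Set.Iic i × (GaugeConfig 3 L (Matrix.specialUnitaryGroup (Fin 2) ℂ) ×
        {p : ℝ≥0 → (Edge 3 L × NoiseIdx 2 → ℝ) // Continuous p ∧ p 0 = 0}) => U q.2.1 q.1 q.2.2))
    {G : Set (GaugeConfig 3 L (Matrix.specialUnitaryGroup (Fin 2) ℂ) ×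
      {p : ℝ≥0 → (Edge 3 L × NoiseIdx 2 → ℝ) // Continuous p ∧ p 0 = 0})} (hGm : MeasurableSet G)
    (hGc : ∀ q ∈ G, Continuous fun r => U q.1 r q.2)
    (hGae : ∀ y, ∀ᵐ q ∂(P.map (fun ω => (⟨fun t => W t ω, continuous_path_and_zero hW ω⟩ :
        {p : ℝ≥0 → (Edge 3 L × NoiseIdx 2 → ℝ) // Continuous p ∧ p 0 = 0}))), (y, q) ∈ G)
    (x : GaugeConfig 3 L (Matrix.specialUnitaryGroup (Fin 2) ℂ)) (s : ℝ≥0) :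
    ∀ᵐ p ∂(P.map (fun ω => (⟨fun t => W t ω, continuous_path_and_zero hW ω⟩ :
        {p : ℝ≥0 → (Edge 3 L × NoiseIdx 2 → ℝ) // Continuous p ∧ p 0 = 0}))),
      Continuous fun u => if u ≤ s then U x u p else U (U x s p) (u - s) ⟨fun v => p.1 (s + v) - p.1 s,
        continuous_shiftPath_and_zero (isFlatBrownian_canonical hW) s p⟩ := by
  -- the restart point is `𝓕_s`-measurable
  have hYs : Measurable[(isFlatBrownian_canonical hW).natFiltration s] (U x s) := by
    have hmap : @Measurable {p : ℝ≥0 → (Edge 3 L × NoiseIdx 2 → ℝ) // Continuous p ∧ p 0 = 0}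
        (Set.Iic s × (GaugeConfig 3 L (Matrix.specialUnitaryGroup (Fin 2) ℂ) ×
          {p : ℝ≥0 → (Edge 3 L × NoiseIdx 2 → ℝ) // Continuous p ∧ p 0 = 0}))
        ((isFlatBrownian_canonical hW).natFiltration s)
        (@Prod.instMeasurableSpace _ _ inferInstance (@Prod.instMeasurableSpace _ _ inferInstance
          ((isFlatBrownian_canonical hW).natFiltration s)))
        (fun p => ((⟨s, Set.mem_Iic.2 le_rfl⟩ : Set.Iic s), (x, p))) :=
      measurable_const.prodMk (measurable_const.prodMk measurable_id)
    have h := (hprog s).comp hmap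
    exact h
  -- sections of the certificate are almost sure
  have hfull : ∀ y, (P.map (fun ω => (⟨fun t => W t ω, continuous_path_and_zero hW ω⟩ :
      {p : ℝ≥0 → (Edge 3 L × NoiseIdx 2 → ℝ) // Continuous p ∧ p 0 = 0}))) (Prod.mk y ⁻¹' G) = 1 := by
    intro y
    haveI : IsProbabilityMeasure (P.map (fun ω => (⟨fun t => W t ω, continuous_path_and_zero hW ω⟩ :
        {p : ℝ≥0 → (Edge 3 L × NoiseIdx 2 → ℝ) // Continuous p ∧ p 0 = 0}))) :=
      Measure.isProbabilityMeasure_map (measurable_pathMap hW).aemeasurable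
    rw [← prob_compl_eq_zero_iff (measurable_prodMk_left hGm)]
    exact ae_iff.1 (hGae y)
  have hsec := ae_mem_of_forall_prob_eq_one hW s hYs hGm hfull
  filter_upwards [hGae x, hsec] with p hx hp
  exact continuous_splice_path s (hGc _ hx) (hGc _ hp) (by rw [hU0])

end Splice

end Summit.QuantumFields.YangMills.Theorems.ColdStartUniversality

end
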